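import Summits.HubbardSuperconductivity.HubbardSuperconductivity.Theorems.CooperPairDMottWalkPlaquetteGramCert

/-!
# Route `CooperPairDMottWalk`, crux `CooperPairDMott`: a bilinear form does not vanish on two
# certified approximate eigen-directions

Helper file for the stub `stub_plaquetteDWaveElement` of the line `Cruxes/CooperPairDMott/Lines/birth.lean`
(item stmt-HubbardSuperconductivity-1177): the finite-dimensional estimate behind
"`⟨φ₂, Δ_d φ₄⟩ ≠ 0` for ALL sector ground states `φ₂`, `φ₄` of the plaquette". Abstractly: an
integer kernel `T : ι → κ → ℤ`, integer reference vectors `u : ι → ℤ`, `v : κ → ℤ`, and complex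
vectors `p`, `s` which are CLOSE TO THE LINES `ℂu`, `ℂv` in the certified form
`g_u ‖p‖² ≤ κ_u |⟨u, p⟩|²`, `g_v ‖s‖² ≤ κ_v |⟨v, s⟩|²` (this is what a spectral-gap certificate
`H + κ u uᵀ ≥ θ` gives for a ground state of `H`). Writing `n_u p = ⟨u,p⟩ u + r`,
`n_v s = ⟨v,s⟩ v + ρ` (`n_u = |u|²`), Pythagoras gives `‖r‖² ≤ n_u (n_u κ_u/g_u − 1) |⟨u,p⟩|²`, and
`n_u n_v ⟨p, T s⟩ = conj⟨u,p⟩ ⟨v,s⟩ (uᵀTv) + conj⟨u,p⟩ ⟨Tᵀu, ρ⟩ + n_v ⟨r, T s⟩`; two Cauchy–Schwarz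
bounds then show `⟨p, T s⟩ ≠ 0` as soon as `|uᵀTv| > A₁ + A₂` with
`A₁² ≥ |Tᵀu|² n_v (n_v κ_v/g_v − 1)` and `A₂² ≥ |T|_F² n_u (n_u κ_u/g_u − 1) n_v (n_v κ_v/g_v)`
(`bilinear_ne_zero_of_near_lines`). Elementary linear algebra; no source needed.
-/

set_option linter.dupNamespace false -- the route namespace `HubbardSuperconductivity.HubbardSuperconductivity` is mandated (D-0017)

noncomputable section

namespace Summit.HubbardSuperconductivity.HubbardSuperconductivity.Theorems.CooperPairDMottWalk

open Finset
open scoped ComplexConjugate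

section CauchySchwarz

variable {ι κ : Type*} [Fintype ι] [Fintype κ]

/-- Cauchy–Schwarz for a complex bilinear pairing, squared: `|Σ aᵢ qᵢ|² ≤ (Σ |aᵢ|²)(Σ |qᵢ|²)`. [folklore] -/
theorem norm_sum_mul_sq_le (a q : ι → ℂ) :
    ‖∑ i, a i * q i‖ ^ 2 ≤ (∑ i, ‖a i‖ ^ 2) * ∑ i, ‖q i‖ ^ 2 := by
  have h1 : ‖∑ i, a i * q i‖ ≤ ∑ i, ‖a i‖ * ‖q i‖ :=
    (norm_sum_le _ _).trans (le_of_eq (Finset.sum_congr rfl fun i _ => norm_mul _ _))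
  exact (pow_le_pow_left₀ (norm_nonneg _) h1 2).trans (Finset.sum_mul_sq_le_sq_mul_sq _ _ _)

/-- Cauchy–Schwarz with integer weights: `|Σ wₖ zₖ|² ≤ (Σ wₖ²)(Σ |zₖ|²)`. [folklore] -/
theorem norm_sum_intCast_mul_sq_le (w : κ → ℤ) (z : κ → ℂ) :
    ‖∑ k, (w k : ℂ) * z k‖ ^ 2 ≤ (∑ k, ((w k : ℝ)) ^ 2) * ∑ k, ‖z k‖ ^ 2 := by
  have h := norm_sum_mul_sq_le (fun k => (w k : ℂ)) z
  simpa only [Complex.norm_intCast, sq_abs] using h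

/-- Cauchy–Schwarz for an integer kernel (Frobenius bound):
`|Σᵢₖ conj(yᵢ) Tᵢₖ zₖ|² ≤ (Σ Tᵢₖ²)(Σ |yᵢ|²)(Σ |zₖ|²)`. [folklore] -/
theorem norm_sum_sum_star_mul_sq_le (T : ι → κ → ℤ) (y : ι → ℂ) (z : κ → ℂ) :
    ‖∑ i, ∑ k, star (y i) * (T i k : ℂ) * z k‖ ^ 2 ≤
      (∑ i, ∑ k, ((T i k : ℝ)) ^ 2) * (∑ i, ‖y i‖ ^ 2) * ∑ k, ‖z k‖ ^ 2 := by
  have hrw : ∑ i, ∑ k, star (y i) * (T i k : ℂ) * z k = ∑ i, star (y i) * ∑ k, (T i k : ℂ) * z k := by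
    refine Finset.sum_congr rfl fun i _ => ?_
    rw [Finset.mul_sum]
    exact Finset.sum_congr rfl fun k _ => by ring
  rw [hrw]
  have h1 := norm_sum_mul_sq_le (fun i => star (y i)) (fun i => ∑ k, (T i k : ℂ) * z k)
  simp only [norm_star] at h1
  have h2 : ∑ i, ‖∑ k, (T i k : ℂ) * z k‖ ^ 2 ≤ (∑ i, ∑ k, ((T i k : ℝ)) ^ 2) * ∑ k, ‖z k‖ ^ 2 := by
    rw [Finset.sum_mul]
    exact Finset.sum_le_sum fun i _ => norm_sum_intCast_mul_sq_le (T i) z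
  calc _ ≤ (∑ i, ‖y i‖ ^ 2) * ∑ i, ‖∑ k, (T i k : ℂ) * z k‖ ^ 2 := h1
    _ ≤ (∑ i, ‖y i‖ ^ 2) * ((∑ i, ∑ k, ((T i k : ℝ)) ^ 2) * ∑ k, ‖z k‖ ^ 2) :=
        mul_le_mul_of_nonneg_left h2 (Finset.sum_nonneg fun i _ => sq_nonneg _)
    _ = _ := by ring

/-- **Pythagoras for the residual of the projection onto an integer direction**:
with `α = Σ uⱼ pⱼ` and `N = Σ uⱼ²`, `Σᵢ |N pᵢ − α uᵢ|² = N² Σ |pᵢ|² − N |α|²`. [folklore] -/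
theorem normSq_residual (u : ι → ℤ) (p : ι → ℂ) {N : ℝ} (hN : (∑ j, ((u j : ℝ)) ^ 2) = N) :
    ∑ i, ‖(N : ℂ) * p i - (∑ j, (u j : ℂ) * p j) * (u i : ℂ)‖ ^ 2 =
      N ^ 2 * (∑ i, ‖p i‖ ^ 2) - N * ‖∑ j, (u j : ℂ) * p j‖ ^ 2 := by
  set α := ∑ j, (u j : ℂ) * p j with hα
  have hαc : conj α = ∑ j, (u j : ℂ) * conj (p j) := by
    rw [hα, map_sum]
    exact Finset.sum_congr rfl fun j _ => by rw [map_mul, map_intCast]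
  have hNc : (N : ℂ) = ∑ j, (u j : ℂ) * (u j : ℂ) := by
    rw [← hN]
    push_cast
    exact Finset.sum_congr rfl fun j _ => by ring
  have e : ∀ i, conj ((N : ℂ) * p i - α * u i) * ((N : ℂ) * p i - α * u i) =
      (N : ℂ) ^ 2 * (conj (p i) * p i) - (N : ℂ) * α * ((u i : ℂ) * conj (p i)) -
        (N : ℂ) * conj α * ((u i : ℂ) * p i) + conj α * α * ((u i : ℂ) * (u i : ℂ)) := by
    intro i
    simp only [map_sub, map_mul, Complex.conj_ofReal, map_intCast]
    ring
  have main : ∑ i, conj ((N : ℂ) * p i - α * u i) * ((N : ℂ) * p i - α * u i) =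
      (N : ℂ) ^ 2 * (∑ i, conj (p i) * p i) - (N : ℂ) * (conj α * α) := by
    simp only [e, Finset.sum_add_distrib, Finset.sum_sub_distrib, ← Finset.mul_sum, ← hαc, ← hα,
      ← hNc]
    ring
  apply Complex.ofReal_injective
  push_cast
  simp only [← Complex.conj_mul']
  exact main

end CauchySchwarz

/-! ### The abstract non-vanishing theorem -/

section NearLines

variable {ι κ : Type*} [Fintype ι] [Fintype κ]

/-- From `g ‖p‖² ≤ κ |α|²` with `g > 0` and `p ≠ 0`: `α ≠ 0`, and `‖p‖² ≤ (κ/g) |α|²`. [folklore] -/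
theorem near_line_aux {g κ P a : ℝ} (hg : 0 < g) (hP : 0 < P) (h : g * P ≤ κ * a ^ 2) (ha : 0 ≤ a) :
    0 < a ∧ P ≤ κ / g * a ^ 2 := by
  refine ⟨?_, ?_⟩
  · rcases ha.lt_or_eq with ha' | ha'
    · exact ha'
    · exfalso
      rw [← ha'] at h
      nlinarith
  · rw [div_mul_eq_mul_div, le_div_iff₀ hg]
    linarith

/-- From `x² ≤ y²` and `y ≥ 0`: `x ≤ y` (for `x ≥ 0`). [folklore] -/
theorem le_of_sq_le_sq' {x y : ℝ} (hx : 0 ≤ x) (hy : 0 ≤ y) (h : x ^ 2 ≤ y ^ 2) : x ≤ y :=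
  (sq_le_sq₀ hx hy).1 h

/-- **A bilinear form does not vanish on two certified near-lines.** Let `T : ι → κ → ℤ`,
`u : ι → ℤ`, `v : κ → ℤ`, and let `p : ι → ℂ`, `s : κ → ℂ` be nonzero with
`g_u ‖p‖² ≤ κ_u |Σ uᵢpᵢ|²`, `g_v ‖s‖² ≤ κ_v |Σ vₖsₖ|²` (`g_u, g_v > 0`). If
`A₁² ≥ |Tᵀu|² · n_v (n_v κ_v/g_v − 1)`, `A₂² ≥ |T|_F² · n_u (n_u κ_u/g_u − 1) · n_v (n_v κ_v/g_v)` and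
`A₁ + A₂ < |uᵀ T v|` (`n_u = |u|²`, `n_v = |v|²`), then `Σᵢₖ conj(pᵢ) Tᵢₖ sₖ ≠ 0`. [folklore] -/
theorem bilinear_ne_zero_of_near_lines (T : ι → κ → ℤ) (u : ι → ℤ) (v : κ → ℤ) (p : ι → ℂ)
    (s : κ → ℂ) {gu κu gv κv nu nv Nw F t0 A₁ A₂ : ℝ}
    (hnu : (∑ i, ((u i : ℝ)) ^ 2) = nu) (hnv : (∑ k, ((v k : ℝ)) ^ 2) = nv)
    (hNw : (∑ k, (((∑ i, u i * T i k : ℤ)) : ℝ) ^ 2) = Nw) (hF : (∑ i, ∑ k, ((T i k : ℝ)) ^ 2) = F)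
    (ht0 : (((∑ i, ∑ k, u i * T i k * v k : ℤ)) : ℝ) = t0)
    (hgu : 0 < gu) (hgv : 0 < gv) (hp : 0 < ∑ i, ‖p i‖ ^ 2) (hs : 0 < ∑ k, ‖s k‖ ^ 2)
    (hP : gu * ∑ i, ‖p i‖ ^ 2 ≤ κu * ‖∑ i, (u i : ℂ) * p i‖ ^ 2)
    (hS : gv * ∑ k, ‖s k‖ ^ 2 ≤ κv * ‖∑ k, (v k : ℂ) * s k‖ ^ 2)
    (hA₁ : 0 ≤ A₁) (hA₂ : 0 ≤ A₂)
    (h1 : Nw * (nv * (nv * κv / gv - 1)) ≤ A₁ ^ 2)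
    (h2 : F * (nu * (nu * κu / gu - 1)) * (nv * (nv * κv / gv)) ≤ A₂ ^ 2)
    (h3 : A₁ + A₂ < |t0|) :
    ∑ i, ∑ k, star (p i) * (T i k : ℂ) * s k ≠ 0 := by
  -- notation
  set α : ℂ := ∑ i, (u i : ℂ) * p i with hα
  set β : ℂ := ∑ k, (v k : ℂ) * s k with hβ
  set Mel : ℂ := ∑ i, ∑ k, star (p i) * (T i k : ℂ) * s k with hMel
  obtain ⟨hαpos, hPle⟩ := near_line_aux hgu hp hP (norm_nonneg α)
  obtain ⟨hβpos, hSle⟩ := near_line_aux hgv hs hS (norm_nonneg β)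
  have hnu0 : 0 ≤ nu := by rw [← hnu]; exact Finset.sum_nonneg fun i _ => sq_nonneg _
  have hnv0 : 0 ≤ nv := by rw [← hnv]; exact Finset.sum_nonneg fun i _ => sq_nonneg _
  -- residuals
  set r : ι → ℂ := fun i => (nu : ℂ) * p i - α * (u i : ℂ) with hr
  set ρ : κ → ℂ := fun k => (nv : ℂ) * s k - β * (v k : ℂ) with hρ
  have hrr : ∑ i, ‖r i‖ ^ 2 ≤ nu * (nu * κu / gu - 1) * ‖α‖ ^ 2 := by
    have h := normSq_residual u p hnu
    rw [← hα] at h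
    simp only [hr]
    rw [h]
    calc nu ^ 2 * (∑ i, ‖p i‖ ^ 2) - nu * ‖α‖ ^ 2 ≤ nu ^ 2 * (κu / gu * ‖α‖ ^ 2) - nu * ‖α‖ ^ 2 :=
          sub_le_sub_right (mul_le_mul_of_nonneg_left hPle (sq_nonneg nu)) _
      _ = nu * (nu * κu / gu - 1) * ‖α‖ ^ 2 := by ring
  have hρρ : ∑ k, ‖ρ k‖ ^ 2 ≤ nv * (nv * κv / gv - 1) * ‖β‖ ^ 2 := by
    have h := normSq_residual v s hnv
    rw [← hβ] at h
    simp only [hρ]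
    rw [h]
    calc nv ^ 2 * (∑ k, ‖s k‖ ^ 2) - nv * ‖β‖ ^ 2 ≤ nv ^ 2 * (κv / gv * ‖β‖ ^ 2) - nv * ‖β‖ ^ 2 :=
          sub_le_sub_right (mul_le_mul_of_nonneg_left hSle (sq_nonneg nv)) _
      _ = nv * (nv * κv / gv - 1) * ‖β‖ ^ 2 := by ring
  -- the two error terms
  set E₁ : ℂ := ∑ k, ((∑ i, u i * T i k : ℤ) : ℂ) * ρ k with hE₁
  set E₂ : ℂ := ∑ i, ∑ k, star (r i) * (T i k : ℂ) * s k with hE₂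
  set t0c : ℂ := ((∑ i, ∑ k, u i * T i k * v k : ℤ) : ℂ) with ht0c
  -- the key identity
  have hX : ∑ k, ((∑ i, u i * T i k : ℤ) : ℂ) * s k = ∑ i, ∑ k, (u i : ℂ) * (T i k : ℂ) * s k := by
    rw [Finset.sum_comm]
    refine Finset.sum_congr rfl fun k _ => ?_
    push_cast
    rw [Finset.sum_mul]
  have hI1 : E₂ = (nu : ℂ) * Mel - conj α * ∑ i, ∑ k, (u i : ℂ) * (T i k : ℂ) * s k := by
    simp only [hE₂, hMel, hr, Finset.mul_sum, ← Finset.sum_sub_distrib]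
    refine Finset.sum_congr rfl fun i _ => Finset.sum_congr rfl fun k _ => ?_
    simp only [star_sub, star_mul, Complex.star_def, Complex.conj_ofReal, map_intCast]
    ring
  have ht0sum : t0c = ∑ k, ((∑ i, u i * T i k : ℤ) : ℂ) * (v k : ℂ) := by
    simp only [ht0c]
    push_cast
    rw [Finset.sum_comm]
    exact Finset.sum_congr rfl fun k _ => by rw [Finset.sum_mul]
  have hI2 : E₁ = (nv : ℂ) * (∑ i, ∑ k, (u i : ℂ) * (T i k : ℂ) * s k) - β * t0c := by
    rw [← hX, ht0sum, hE₁, Finset.mul_sum, Finset.mul_sum, ← Finset.sum_sub_distrib]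
    simp only [hρ]
    exact Finset.sum_congr rfl fun k _ => by ring
  have key : (nu : ℂ) * (nv : ℂ) * Mel = conj α * β * t0c + conj α * E₁ + (nv : ℂ) * E₂ := by
    rw [hI1, hI2]; ring
  -- bounds on the error terms
  have hE₁b : ‖E₁‖ ≤ A₁ * ‖β‖ := by
    have hcs := norm_sum_intCast_mul_sq_le (fun k => (∑ i, u i * T i k : ℤ)) ρ
    rw [hNw] at hcs
    refine le_of_sq_le_sq' (norm_nonneg _) (mul_nonneg hA₁ (norm_nonneg _)) ?_
    have hNw0 : 0 ≤ Nw := by rw [← hNw]; exact Finset.sum_nonneg fun _ _ => sq_nonneg _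
    calc ‖E₁‖ ^ 2 ≤ Nw * ∑ k, ‖ρ k‖ ^ 2 := hcs
      _ ≤ Nw * (nv * (nv * κv / gv - 1) * ‖β‖ ^ 2) := mul_le_mul_of_nonneg_left hρρ hNw0
      _ ≤ A₁ ^ 2 * ‖β‖ ^ 2 := by nlinarith [sq_nonneg ‖β‖]
      _ = (A₁ * ‖β‖) ^ 2 := by ring
  have hE₂b : nv * ‖E₂‖ ≤ A₂ * ‖α‖ * ‖β‖ := by
    have hcs := norm_sum_sum_star_mul_sq_le T r s
    rw [hF] at hcs
    have hF0 : 0 ≤ F := by rw [← hF]; exact Finset.sum_nonneg fun _ _ => Finset.sum_nonneg fun _ _ => sq_nonneg _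
    refine le_of_sq_le_sq' (mul_nonneg hnv0 (norm_nonneg _))
      (mul_nonneg (mul_nonneg hA₂ (norm_nonneg _)) (norm_nonneg _)) ?_
    have hr0 : 0 ≤ ∑ i, ‖r i‖ ^ 2 := Finset.sum_nonneg fun _ _ => sq_nonneg _
    calc (nv * ‖E₂‖) ^ 2 = nv ^ 2 * ‖E₂‖ ^ 2 := by ring
      _ ≤ nv ^ 2 * (F * (∑ i, ‖r i‖ ^ 2) * ∑ k, ‖s k‖ ^ 2) :=
          mul_le_mul_of_nonneg_left hcs (sq_nonneg _)
      _ ≤ nv ^ 2 * (F * (nu * (nu * κu / gu - 1) * ‖α‖ ^ 2) * (κv / gv * ‖β‖ ^ 2)) := by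
          apply mul_le_mul_of_nonneg_left _ (sq_nonneg _)
          exact mul_le_mul (mul_le_mul_of_nonneg_left hrr hF0) hSle hs.le
            (mul_nonneg hF0 (le_trans hr0 hrr))
      _ = F * (nu * (nu * κu / gu - 1)) * (nv * (nv * κv / gv)) * (‖α‖ ^ 2 * ‖β‖ ^ 2) := by ring
      _ ≤ A₂ ^ 2 * (‖α‖ ^ 2 * ‖β‖ ^ 2) :=
          mul_le_mul_of_nonneg_right h2 (mul_nonneg (sq_nonneg _) (sq_nonneg _))
      _ = (A₂ * ‖α‖ * ‖β‖) ^ 2 := by ring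
  -- conclusion
  intro hzero
  have hMel0 : Mel = 0 := hzero
  have ht0c : ‖t0c‖ = |t0| := by rw [ht0c, Complex.norm_intCast, ht0]
  have hmain : conj α * β * t0c = -(conj α * E₁ + (nv : ℂ) * E₂) := by
    have := key
    rw [hMel0, mul_zero] at this
    linear_combination -this
  have hnorm : ‖α‖ * ‖β‖ * |t0| ≤ ‖α‖ * (A₁ * ‖β‖) + A₂ * ‖α‖ * ‖β‖ := by
    calc ‖α‖ * ‖β‖ * |t0| = ‖conj α * β * t0c‖ := by
          rw [norm_mul, norm_mul, Complex.norm_conj, ht0c]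
      _ = ‖conj α * E₁ + (nv : ℂ) * E₂‖ := by rw [hmain, norm_neg]
      _ ≤ ‖conj α * E₁‖ + ‖(nv : ℂ) * E₂‖ := norm_add_le _ _
      _ = ‖α‖ * ‖E₁‖ + nv * ‖E₂‖ := by
          rw [norm_mul, norm_mul, Complex.norm_conj, Complex.norm_real, Real.norm_of_nonneg hnv0]
      _ ≤ ‖α‖ * (A₁ * ‖β‖) + A₂ * ‖α‖ * ‖β‖ :=
          add_le_add (mul_le_mul_of_nonneg_left hE₁b (norm_nonneg _)) hE₂b
  have hab : 0 < ‖α‖ * ‖β‖ := mul_pos hαpos hβpos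
  nlinarith

end NearLines

/-! ### Registered sub-goal of the crux item (stmt-HubbardSuperconductivity-1177) -/

/-- Registered sub-goal `dWaveElement_bilinearNeZero` of the crux item: the near-lines non-vanishing theorem (`bilinear_ne_zero_of_near_lines`, monomorphic restatement). [folklore] -/
theorem dWaveElement_bilinearNeZero : ∀ {ι κ : Type} [Fintype ι] [Fintype κ] (T : ι → κ → ℤ) (u : ι → ℤ) (v : κ → ℤ) (p : ι → ℂ) (s : κ → ℂ) {gu κu gv κv nu nv Nw F t0 A₁ A₂ : ℝ}, (∑ i, ((u i : ℝ)) ^ 2) = nu → (∑ k, ((v k : ℝ)) ^ 2) = nv → (∑ k, (((∑ i, u i * T i k : ℤ)) : ℝ) ^ 2) = Nw → (∑ i, ∑ k, ((T i k : ℝ)) ^ 2) = F → (((∑ i, ∑ k, u i * T i k * v k : ℤ)) : ℝ) = t0 → 0 < gu → 0 < gv → 0 < ∑ i, ‖p i‖ ^ 2 → 0 < ∑ k, ‖s k‖ ^ 2 → gu * ∑ i, ‖p i‖ ^ 2 ≤ κu * ‖∑ i, (u i : ℂ) * p i‖ ^ 2 → gv * ∑ k, ‖s k‖ ^ 2 ≤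 κv * ‖∑ k, (v k : ℂ) * s k‖ ^ 2 → 0 ≤ A₁ → 0 ≤ A₂ → Nw * (nv * (nv * κv / gv - 1)) ≤ A₁ ^ 2 → F * (nu * (nu * κu / gu - 1)) * (nv * (nv * κv / gv)) ≤ A₂ ^ 2 → A₁ + A₂ < |t0| → ∑ i, ∑ k, star (p i) * (T i k : ℂ) * s k ≠ 0 :=
  by
  intro ι κ _ _ T u v p s gu κu gv κv nu nv Nw F t0 A₁ A₂ hnu hnv hNw hF ht0 hgu hgv hp hs hP hS hA₁ hA₂ h1 h2 h3
  exact bilinear_ne_zero_of_near_lines T u v p s hnu hnv hNw hF ht0 hgu hgv hp hs hP hS hA₁ hA₂ h1 h2 h3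

end Summit.HubbardSuperconductivity.HubbardSuperconductivity.Theorems.CooperPairDMottWalk
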